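import Summits.BirchSwinnertonDyer.BirchSwinnertonDyer.Theorems.GenusKolyvaginAtTwoEquivariantKolyvaginExactAtTwoCebotarevVisibleRatTwoRays
import Summits.BirchSwinnertonDyer.BirchSwinnertonDyer.Theorems.GenusKolyvaginAtTwoVisiblePairAtTwoDefs
import Literature.NumberTheory.EllipticCurves.HeegnerPointsKolyvaginPrimaryCebotarevProofs
import HarnessLib

/-!
# Route `GenusKolyvaginAtTwo`, LINE 6, KEY crux Q3 (inner statement of stmt-BirchSwinnertonDyer-22137):
# the Čebotarev inputs of the INSTANCE `VisiblePairAtTwo` DISCHARGED — `Input.cebotarev` and the two-ray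
# `hCeb`, in the instance's own currency (helper, PROVED; seat `bsd-line-gk2-p2` g11)

Seat gk2-p3's `…VisiblePairAtTwoDefs` (p638903) instantiates gk2-p2's `KolyvaginDescent.VisiblePairHypothesesM`
at `2` over `ℚ` for the pair `(E, E^{(d_K)})`, bundling the underived axioms in `VisiblePairAtTwo.Input`; among
them the field `cebotarev` (Cor. 3.2 in visible form, currency `rK₁`/`rK₂ : V_i →+ HK`, `kolPrime`, `a₁`/`a₂`).
This file REMOVES it from the displayed inputs on the LINE-6 habitat:

* `input_cebotarev` — **the field `Input.cebotarev`, literally, PROVED** for `E` globally minimal non-CM with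
  `Δ(E) < 0`, `ρ_{E,2^n}` onto for all `n`, `K = ℚ(θ)` imaginary quadratic with `θ² = d_K` odd and
  `d_K·(−|Δ|)` not a square, `M ≥ 1` (from `SelmerDescent.cebotarev_visible_rat_field_of_not_isSquare`,
  p638752: `∑ aᵢ(rK₁ uᵢ + rK₂ yᵢ) = 0` in `HK` IS the triviality of `[∑ aᵢ(res uᵢ + hPsiKT(res yᵢ)), ρ]` on
  `Γ_{K(E[2^M])}`; `kolPrime` from Zhang's predicate at level `N_E`, `Frob` at depths `2^M` and `2`
  (`FrobEqFrobInfty.of_dvd`) and `f(w|ℓ) = 2` (`inertiaDeg_eq_two_of_span_isPrime`); `a₁`/`a₂` by `mem_a₁_iff`/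
  `mem_a₂_iff`);
* `hCeb_two_rays` — **the hypothesis `hCeb` of `VisiblePairHypothesesM.sel₁_eq_and_card_sel₂_eq_of_primitive` in
  the instance's currency** (`kolPrime`, `a₁ × a₂`, `rK₁ + rK₂`-injectivity on the span of `{g₁, g₂} ∪ T`,
  purity as `t.2 = 0 ∨ t.1 = 0`), from `SelmerDescent.two_rays_visible_rat_of_not_isSquare`.

Helper (`--supports` 22137), closes nothing; THEOREMS ONLY, 0 sorry, standard axioms, no named fact. Nothing
here is a claim about BSD, about Q2, or about (H2).

References: [McCallumLMS1991] p. 299, §3 Prop. 3.1 and Cor. 3.2, §5 (21)–(23); [GrossLMS1991] §3, §9;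
[Kolyvagin1989Izv] §3.
-/

set_option autoImplicit false
set_option linter.dupNamespace false -- tree convention: `Summit.BirchSwinnertonDyer.BirchSwinnertonDyer.Theorems` (summit = sub-problem)

noncomputable section

open scoped Classical

namespace Summit.BirchSwinnertonDyer.BirchSwinnertonDyer.Theorems.GenusExact.VisiblePairAtTwo

open WeierstrassCurve NumberField IsDedekindDomain Field Finset Rat.HeightOneSpectrum
open Literature.NumberTheory.EllipticCurves Literature.NumberTheory.GaloisRepresentations
open Literature.NumberTheory.EllipticCurves.KolyvaginDescent
open Summit.BirchSwinnertonDyer.BirchSwinnertonDyer.Theorems.GenusExact.SelmerDescent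

variable (W : WeierstrassCurve ℚ) [W.IsElliptic] [W.IsGloballyMinimal] (K : Type) [Field K] [NumberField K]
  (M : ℕ) {θ : K} (hθ : θ ∉ Set.range (algebraMap ℚ K))
  (hθsq : θ ^ 2 = algebraMap ℚ K ((NumberField.discr K : ℤ) : ℚ))

/-! ## §1 Reading `HK`-relations as triviality of the pairing on `Γ_{K(E[2^M])}` -/

omit [W.IsElliptic] [W.IsGloballyMinimal] in
/-- **A relation `∑ aᵢ (rK₁ uᵢ + rK₂ yᵢ) = 0` in `HK` is the triviality of `[∑ aᵢ (res uᵢ + hPsiKT (res yᵢ)), ρ]`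
for every `ρ ∈ Γ_{K(E[2^M])}`** (evaluation at `ρ`; `[·, ρ]` is additive there). [cite: McCallumLMS1991, p. 299 and §3 (2)] -/
theorem sum_rK_eq_zero_iff {r : ℕ} (cs : Fin r → galH1Torsion W (lvl M) × galH1Torsion (twin W K) (lvl M))
    (a : Fin r → ℤ) :
    ∑ i, a i • (rK₁ W K M (cs i).1 + rK₂ W M hθ hθsq (cs i).2) = 0 ↔
      ∀ ρ ∈ torsionFixing (W.baseChange K) (lvl M),
        h1Eval (W.baseChange K) (lvl M) (∑ i, a i • (resTorsion W K (lvl M) (cs i).1 +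
          hPsiKT W K hθ hθsq (lvl M) (resTorsion (twin W K) K (lvl M) (cs i).2))) ρ = 0 := by
  have key : ∀ ρ : torsionFixing (W.baseChange K) (lvl M),
      (∑ i, a i • (rK₁ W K M (cs i).1 + rK₂ W M hθ hθsq (cs i).2)) ρ =
        h1Eval (W.baseChange K) (lvl M) (∑ i, a i • (resTorsion W K (lvl M) (cs i).1 +
          hPsiKT W K hθ hθsq (lvl M) (resTorsion (twin W K) K (lvl M) (cs i).2))) ρ := by
    intro ρ
    rw [Finset.sum_apply, h1Eval_sum _ _ _ _ ρ.2]
    refine Finset.sum_congr rfl fun i _ ↦ ?_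
    rw [Pi.smul_apply, Pi.add_apply, rK₁_apply, rK₂_apply, h1Eval_zsmul _ _ _ _ ρ.2,
      h1Eval_add _ _ _ _ ρ.2]
  constructor
  · intro h ρ hρ
    have := congrFun h ⟨ρ, hρ⟩
    rwa [key, Pi.zero_apply] at this
  · intro h
    funext ρ
    rw [key, Pi.zero_apply]
    exact h ρ ρ.2

/-! ## §2 The field `Input.cebotarev`, discharged -/

/-- `kolPrime` from the strong currency: Zhang's predicate at the level of the conductor, `Frob_ℓ = Frob_∞` on
`K(E[2^M])` and `M ≤ M(ℓ)` give the instance's Kolyvagin-prime predicate (`Frob` at depth `2` by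
`E[2] ⊆ E[2^M]`; residue degree `2` at the inert `ℓ`). [cite: GrossLMS1991, §3 (3.1)–(3.3)] -/
theorem kolPrime_of_isKolyvaginPrime (hK : IsImaginaryQuadratic K) {N : ℕ} (hN : W.conductorNorm ℤ ∣ N)
    (hM : 1 ≤ M) {ℓ : ℕ} (hFrob : FrobEqFrobInfty W K (2 ^ M) ℓ) (hKol : Zhang2014.IsKolyvaginPrime N W K 2 ℓ)
    (hidx : M ≤ Zhang2014.kolyvaginIndex W 2 ℓ) : kolPrime W K M ℓ := by
  have hℓ : ℓ.Prime := hKol.1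
  haveI : Fact ℓ.Prime := ⟨hℓ⟩
  have hℓN : ¬ ℓ ∣ W.conductorNorm ℤ := fun h ↦ hKol.2.1 (h.trans hN)
  refine ⟨hℓ, hKol.2.2.2.1, hKol.2.2.1, hasGoodReductionAtPrime_of_not_dvd_conductorNorm W hℓN, hFrob,
    FrobEqFrobInfty.of_dvd (dvd_pow_self 2 (by omega)) hFrob, hidx, fun w hw ↦ ?_⟩
  exact inertiaDeg_eq_two_of_span_isPrime hK.1 hℓ hKol.2.2.2.2.1 (natCast_mem_primesEquiv_symm hℓ) hw

/-- **The field `Input.cebotarev` of the instance, PROVED on the LINE-6 habitat** (`E` globally minimal non-CM,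
`Δ(E) < 0`, `ρ_{E,2^n}` onto for all `n`, `K` imaginary quadratic with `d_K` odd, `θ² = d_K`, `d_K·(−|Δ|)` not a
square, `M ≥ 1`): Cor. 3.2 in visible form for pure families of `H¹(ℚ, E[2^M]) × H¹(ℚ, E^{(d_K)}[2^M])` independent
after `rK₁ + rK₂`, with the Kolyvagin primes `kolPrime` and the strict conditions `a₁ × a₂` of `…VisiblePairAtTwoDefs`.
[cite: McCallumLMS1991, §3 Cor. 3.2 (p. 299)] [cite: Kolyvagin1989Izv, §3] -/
theorem input_cebotarev (hcm : ¬ W.HasCM) (hΔ : W.Δ < 0) (hK : IsImaginaryQuadratic K)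
    (hodd : Odd (NumberField.discr K)) (hns : ¬ IsSquare ((NumberField.discr K : ℚ) * -|W.Δ|))
    (hρ : ∀ n : ℕ, W.HasSurjectiveModNGaloisRep (2 ^ n : ℕ)) [(twin W K).IsElliptic] (hM : 1 ≤ M) :
    ∀ (r : ℕ) (cs : Fin r → galH1Torsion W (lvl M) × galH1Torsion (twin W K) (lvl M))
      (Nv : Fin r → ℕ), (∀ i, cs i ≠ 0) → (∀ i, Nv i ≠ 0 → ((2 : ℤ) ^ (Nv i - 1)) • cs i ≠ 0) →
      (∀ i, (cs i).2 = 0 ∨ (cs i).1 = 0) →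
      (∀ a : Fin r → ℤ, ∑ i, a i • (rK₁ W K M (cs i).1 + rK₂ W M hθ hθsq (cs i).2) = 0 →
        ∀ i, a i • cs i = 0) →
      ∀ b : ℕ, ∃ ℓ, b < ℓ ∧ kolPrime W K M ℓ ∧ ∀ i, ((2 : ℤ) ^ Nv i) • cs i ∈ (a₁ W M ℓ).prod (a₂ W K M ℓ) ∧
        (Nv i ≠ 0 → ((2 : ℤ) ^ (Nv i - 1)) • cs i ∉ (a₁ W M ℓ).prod (a₂ W K M ℓ)) := by
  intro r cs Nv h0 hNv hpure hind b
  haveI : NeZero (W.conductorNorm ℤ) := ⟨(W.conductorNorm_pos_holds).ne'⟩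
  have hvis : ∀ a : Fin r → ℤ, (∀ ρ ∈ torsionFixing (W.baseChange K) (lvl M),
      h1Eval (W.baseChange K) (lvl M) (∑ i, a i • (resTorsion W K (lvl M) (cs i).1 +
        hPsiKT W K hθ hθsq (lvl M) (resTorsion (twin W K) K (lvl M) (cs i).2))) ρ = 0) →
      ∀ i, a i • cs i = 0 :=
    fun a ha ↦ hind a ((sum_rK_eq_zero_iff W K M hθ hθsq cs a).mpr ha)
  obtain ⟨ℓ, hbℓ, ⟨hFrob, hKol, hidx⟩, hloc⟩ := cebotarev_visible_rat_field_of_not_isSquare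
    (W.conductorNorm ℤ) W dvd_rfl hcm hΔ K hK hodd hns hρ hθ hθsq M hM rfl r cs Nv h0 hNv hpure hvis b
  have hℓ : ℓ.Prime := hKol.1
  refine ⟨ℓ, hbℓ, kolPrime_of_isKolyvaginPrime W K M hK dvd_rfl hM hFrob hKol hidx, fun i ↦ ?_⟩
  obtain ⟨hin, hout⟩ := hloc (primesEquiv.symm ⟨ℓ, hℓ⟩) (natCast_mem_primesEquiv_symm hℓ) i
  refine ⟨?_, fun hN0 hmem ↦ hout hN0 ?_⟩
  · rw [AddSubgroup.mem_prod, mem_a₁_iff hℓ, mem_a₂_iff hℓ]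
    exact AddSubgroup.mem_prod.mp hin
  · rw [AddSubgroup.mem_prod, mem_a₁_iff hℓ, mem_a₂_iff hℓ] at hmem
    exact AddSubgroup.mem_prod.mpr hmem

/-! ## §3 The two-ray `hCeb` in the instance's currency -/

/-- **The hypothesis `hCeb` of `VisiblePairHypothesesM.sel₁_eq_and_card_sel₂_eq_of_primitive` for the instance,
PROVED on the LINE-6 habitat** (McCallum's Prop. 3.1 in kernel form on two rays, visible span): for a finite set
`T` of pure classes and pure `g₁, g₂` with `rK₁ + rK₂` injective on the span of `{g₁, g₂} ∪ T`, and every `b`: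
a Kolyvagin prime `ℓ > b` (`kolPrime`) with `T ⊆ a₁ ℓ × a₂ ℓ` and `2^j g_k ∈ a₁ ℓ × a₂ ℓ ⟺ 2^j g_k ∈ ⟨T⟩`
(`k = 1, 2`, all `j`). [cite: McCallumLMS1991, Prop. 3.1 with §3 (2)–(3); §5 (21)–(23)] [cite: GrossLMS1991, §9] -/
theorem hCeb_two_rays (hcm : ¬ W.HasCM) (hΔ : W.Δ < 0) (hK : IsImaginaryQuadratic K)
    (hodd : Odd (NumberField.discr K)) (hns : ¬ IsSquare ((NumberField.discr K : ℚ) * -|W.Δ|))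
    (hρ : ∀ n : ℕ, W.HasSurjectiveModNGaloisRep (2 ^ n : ℕ)) [(twin W K).IsElliptic] (hM : 1 ≤ M)
    (T : Finset (galH1Torsion W (lvl M) × galH1Torsion (twin W K) (lvl M)))
    (g₁ g₂ : galH1Torsion W (lvl M) × galH1Torsion (twin W K) (lvl M))
    (hg₁ : g₁.2 = 0 ∨ g₁.1 = 0) (hg₂ : g₂.2 = 0 ∨ g₂.1 = 0) (hT : ∀ t ∈ T, t.2 = 0 ∨ t.1 = 0)
    (hind : ∀ g ∈ AddSubgroup.closure (insert g₁ (insert g₂ (T : Set _))),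
      rK₁ W K M g.1 + rK₂ W M hθ hθsq g.2 = 0 → g = 0)
    (b : ℕ) :
    ∃ ℓ, b < ℓ ∧ kolPrime W K M ℓ ∧ (∀ t ∈ T, t ∈ (a₁ W M ℓ).prod (a₂ W K M ℓ)) ∧
      (∀ j : ℕ, ((2 : ℤ) ^ j) • g₁ ∈ (a₁ W M ℓ).prod (a₂ W K M ℓ) ↔
        ((2 : ℤ) ^ j) • g₁ ∈ AddSubgroup.closure (T : Set _)) ∧
      (∀ j : ℕ, ((2 : ℤ) ^ j) • g₂ ∈ (a₁ W M ℓ).prod (a₂ W K M ℓ) ↔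
        ((2 : ℤ) ^ j) • g₂ ∈ AddSubgroup.closure (T : Set _)) := by
  haveI : NeZero (W.conductorNorm ℤ) := ⟨(W.conductorNorm_pos_holds).ne'⟩
  -- `rK₁ g.1 + rK₂ g.2 = 0` is the triviality of `[res g.1 + hPsiKT (res g.2), ρ]` (the case `r = 1`, `a = 1`)
  have hvis : ∀ g ∈ AddSubgroup.closure (insert g₁ (insert g₂ (T : Set _))),
      (∀ ρ ∈ torsionFixing (W.baseChange K) (lvl M),
        h1Eval (W.baseChange K) (lvl M) (resTorsion W K (lvl M) g.1 + hPsiKT W K hθ hθsq (lvl M)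
          (resTorsion (twin W K) K (lvl M) g.2)) ρ = 0) → g = 0 := by
    intro g hg hev
    refine hind g hg ?_
    have h := (sum_rK_eq_zero_iff W K M hθ hθsq (fun _ : Fin 1 ↦ g) (fun _ ↦ 1)).mpr (fun ρ hρ ↦ by
      rw [Fin.sum_univ_one, one_zsmul]; exact hev ρ hρ)
    rw [Fin.sum_univ_one, one_zsmul] at h
    exact h
  obtain ⟨ℓ, hbℓ, hFrob, hKol, hidx, hloc⟩ := two_rays_visible_rat_of_not_isSquare (W.conductorNorm ℤ) W
    dvd_rfl hcm hΔ K hK hodd hns hρ hθ hθsq M hM rfl T g₁ g₂ hg₁ hg₂ hT hvis b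
  have hℓ : ℓ.Prime := hKol.1
  obtain ⟨hTin, hray₁, hray₂⟩ := hloc (primesEquiv.symm ⟨ℓ, hℓ⟩) (natCast_mem_primesEquiv_symm hℓ)
  have hprod : ∀ z : galH1Torsion W (lvl M) × galH1Torsion (twin W K) (lvl M),
      z ∈ (a₁ W M ℓ).prod (a₂ W K M ℓ) ↔
        z ∈ (W.torsionLocalKer ((primesEquiv.symm ⟨ℓ, hℓ⟩ : HeightOneSpectrum (𝓞 ℚ)).adicCompletion ℚ)
            (lvl M)).prod
          ((twin W K).torsionLocalKer ((primesEquiv.symm ⟨ℓ, hℓ⟩ : HeightOneSpectrum (𝓞 ℚ)).adicCompletion ℚ)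
            (lvl M)) := fun z ↦ by
    rw [AddSubgroup.mem_prod, AddSubgroup.mem_prod, mem_a₁_iff hℓ, mem_a₂_iff hℓ]
  refine ⟨ℓ, hbℓ, kolPrime_of_isKolyvaginPrime W K M hK dvd_rfl hM hFrob hKol hidx,
    fun t ht ↦ (hprod t).mpr (hTin t ht), fun j ↦ ?_, fun j ↦ ?_⟩
  · rw [hprod]; exact hray₁ j
  · rw [hprod]; exact hray₂ j

end Summit.BirchSwinnertonDyer.BirchSwinnertonDyer.Theorems.GenusExact.VisiblePairAtTwo

end
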